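import Summits.CriticalPhenomena.CardyFormulaZ2.Theorems.CardyComplexConeParafermionToSLESixFamiliesDiamondBIdGeometry
import Summits.CriticalPhenomena.CardyFormulaZ2.Theorems.CardyComplexConeParafermionToSLESixFamiliesDiamondBIdSector
import HarnessLib

/-!
# Line `potential-darboux-picard-diamond`, stub S4v (`stub_boundaryIdentification`): the local bound at a break point

Helper file of the stub `stub_boundaryIdentification` of crux `ParafermionToSLESixFamilies` (stmt-CriticalPhenomena-11389).
THE LOCAL EXPONENT COUNT of step (v) of the identification engine (`localBreakBound`, registered helper). Let `p` be a
holomorphic map of the open half-disc `B(0,r) ∩ {im > 0}` into the diamond `D` with a continuous extension `P` to the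
closed half-disc sending `0` to the break point `v = ℓ(t (j+1))` and the diameter into the two adjacent closed pieces,
and let `G` be the conformal map of `D` onto the interior of the limit hexagon (TURN rule `θ_j = ⅔ g_j + π/3·[mark]`,
weak monotonicity along `d_j` on piece `j`). Straightening the diamond at `v` (`(P - v)/u_{j+1}`, sector of opening
`π - g_j ∈ {π, π/2}`: `germ_bounds` / `corner_deriv_bounds`) and the hexagon at `G v` (`(G ∘ P - G v)/d_{j+1}`, opening
`π - θ_j ∈ {2π/3, π/3}`: `hex23_deriv_bound` / `hex13_deriv_bound`) gives, in each of the three admissible cases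
(mark on a side, unmarked corner, marked corner), the bound `‖G′(p ζ)‖³ ‖ζ‖ ‖p′ ζ‖ ≤ C` near `0`, and
`‖G′(p ζ)‖³ ‖p′ ζ‖ ≤ C` when `v` is not a mark: the exponents of `(G′)³` and of `ψ/ψ′` cancel.
-/

noncomputable section

namespace Summit.CriticalPhenomena.CardyFormulaZ2.Cruxes.ParafermionToSLESixFamilies.PotentialDarbouxPicardDiamond

open scoped Topology Real ComplexConjugate
open Filter Set Metric Complex
open Literature.Probability.RandomPlanarGeometry

/-- The mark indicator takes the values `0` and `1` only. -/
theorem markInd_eq_zero_or_one (D : DobrushinDomain) (v : ℂ) : markInd D v = 0 ∨ markInd D v = 1 := by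
  unfold markInd; split_ifs <;> simp

/-- Derivative of a straightened map: if `F = (q - c)/w` on the open half-disc near `ζ`, then `F′ ζ = q′ ζ / w`. -/
theorem deriv_straighten {F q : ℂ → ℂ} {c w ζ : ℂ} {r : ℝ} (hζ : ζ ∈ ball (0:ℂ) r) (hζim : 0 < ζ.im)
    (hF : ∀ z ∈ ball (0:ℂ) r, 0 < z.im → F z = (q z - c) / w) : deriv F ζ = deriv q ζ / w := by
  have hev : F =ᶠ[𝓝 ζ] fun z => (q z - c) / w := by
    filter_upwards [(isOpen_ball.inter (isOpen_lt continuous_const continuous_im)).mem_nhds ⟨hζ, hζim⟩] with z hz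
    exact hF z hz.1 hz.2
  rw [hev.deriv_eq, deriv_div_const, deriv_sub_const]

/-- **THE LOCAL BOUND AT A BREAK POINT** (registered helper; see the module docstring). -/
theorem localBreakBound : ∀ (D : DobrushinDomain) (ℓ : ℝ → ℂ) (t : ℕ → ℝ) (G : ℂ → ℂ) (d : ℕ → ℂ) (K : Set ℂ), (∀ j, t j < t (j + 1)) → (∀ j, IsBdrySegment D (ℓ (t j)) (ℓ (t (j + 1)))) → (∀ (j : ℕ) (s : ℝ), t j ≤ s → s ≤ t (j + 1) → ℓ s = ℓ (t j) + (((s - t j) / (t (j + 1) - t j) : ℝ) : ℂ) * (ℓ (t (j + 1)) - ℓ (t j))) → ‖d 0‖ = 1 → (∀ j, d (j + 1) = d j * Complex.exp ((((2 / 3 : ℝ) * ((ℓ (t (j + 2)) - ℓ (t (j + 1))) / (ℓ (t (j + 1)) - ℓ (t j))).arg + Real.pi / 3 * markInd D (ℓ (t (j + 1)))) : ℝ) * Complex.I)) → (∀ j, ((ℓ (t (j + 2)) - ℓ (t (j + 1))) / (ℓ (t (j + 1)) - ℓ (t j))).arg = 0 ∨ ((ℓ (t (j + 2)) - ℓ (t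 (j + 1))) / (ℓ (t (j + 1)) - ℓ (t j))).arg = Real.pi / 2) → (∀ j, (2 / 3 : ℝ) * ((ℓ (t (j + 2)) - ℓ (t (j + 1))) / (ℓ (t (j + 1)) - ℓ (t j))).arg + Real.pi / 3 * markInd D (ℓ (t (j + 1))) = Real.pi / 3 ∨ (2 / 3 : ℝ) * ((ℓ (t (j + 2)) - ℓ (t (j + 1))) / (ℓ (t (j + 1)) - ℓ (t j))).arg + Real.pi / 3 * markInd D (ℓ (t (j + 1))) = 2 * Real.pi / 3) → ContinuousOn G (closure D.carrier) → DifferentiableOn ℂ G D.carrier → G '' D.carrier = interior K → (∀ w₀ ∈ interior K, ∀ j : ℕ, 0 < ((w₀ - G (ℓ (t j))) * (starRingEnd ℂ) (d j)).im) → (∀ (j : ℕ) (s s' : ℝ), t j ≤ s → s ≤ s' → s' ≤ t (j + 1) → ∃ r : ℝ, 0 ≤ r ∧ G (ℓ s') - G (ℓ s) = r * d j) → ∀ (j : ℕ) (r : ℝ) (p P : ℂ → ℂ), 0 < r → ContinuousOn P (Metric.ball (0:ℂ) r ∩ {z : ℂ | 0 ≤ z.im}) → DifferentiableOn ℂ p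 (Metric.ball (0:ℂ) r ∩ {z : ℂ | 0 < z.im}) → (∀ z ∈ Metric.ball (0:ℂ) r, 0 < z.im → P z = p z) → P 0 = ℓ (t (j + 1)) → (∀ z ∈ Metric.ball (0:ℂ) r, 0 < z.im → p z ∈ D.carrier) → (∀ z ∈ Metric.ball (0:ℂ) r, 0 ≤ z.im → P z ∈ closure D.carrier) → (∀ z ∈ Metric.ball (0:ℂ) r, z.im = 0 → P z ∈ segment ℝ (ℓ (t j)) (ℓ (t (j + 1))) ∨ P z ∈ segment ℝ (ℓ (t (j + 1))) (ℓ (t (j + 1 + 1)))) → ∃ C r' : ℝ, 0 < C ∧ 0 < r' ∧ r' ≤ r ∧ ∀ ζ ∈ Metric.ball (0:ℂ) r', 0 < ζ.im → ‖deriv G (p ζ)‖ ^ 3 * ‖ζ‖ * ‖deriv p ζ‖ ≤ C ∧ (markInd D (ℓ (t (j + 1))) = 0 → ‖deriv G (p ζ)‖ ^ 3 * ‖deriv p ζ‖ ≤ C) := by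
  intro D ℓ t G d K htlt hseg haff hd0 hd harg hθcases hGc hGd hGim hstrict hmono j r p P hr hPc hp hpP hP0 hpD hPcl
    hPdiam
  have hne : ∀ j, ℓ (t j) ≠ ℓ (t (j + 1)) := fun j => (hseg j).1
  set θf : ℕ → ℝ := fun j => (2 / 3 : ℝ) * ((ℓ (t (j + 2)) - ℓ (t (j + 1))) / (ℓ (t (j + 1)) - ℓ (t j))).arg +
    Real.pi / 3 * markInd D (ℓ (t (j + 1))) with hθf
  have hd' : ∀ j, d (j + 1) = d j * exp (θf j * I) := hd
  have hd1 : ∀ j, ‖d j‖ = 1 := norm_dir_eq_one hd0 hd'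
  have hπ := Real.pi_pos
  have hθ : ∀ j, 0 < θf j ∧ θf j < π := fun j => by
    rcases hθcases j with h | h
    · have : θf j = π / 3 := h
      rw [this]; constructor <;> linarith
    · have : θf j = 2 * π / 3 := h
      rw [this]; constructor <;> linarith
  -- the data at the break point
  set v : ℂ := ℓ (t (j + 1)) with hv
  set u1 : ℂ := (ℓ (t (j + 1 + 1)) - ℓ (t (j + 1))) / (‖ℓ (t (j + 1 + 1)) - ℓ (t (j + 1))‖ : ℂ) with hu1
  set g : ℝ := ((ℓ (t (j + 2)) - ℓ (t (j + 1))) / (ℓ (t (j + 1)) - ℓ (t j))).arg with hg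
  set m : ℝ := markInd D (ℓ (t (j + 1))) with hm
  have hu1n : ‖u1‖ = 1 := norm_unitDir (hne (j + 1))
  have hu1ne : u1 ≠ 0 := fun h => by rw [h, norm_zero] at hu1n; exact zero_ne_one hu1n
  have hd1ne : d (j + 1) ≠ 0 := fun h => by have := hd1 (j + 1); rw [h, norm_zero] at this; exact zero_ne_one this
  have hopen : IsOpen (ball (0:ℂ) r ∩ {z : ℂ | 0 < z.im}) := isOpen_ball.inter (isOpen_lt continuous_const continuous_im)
  -- the straightened maps
  set FP : ℂ → ℂ := fun z => (P z - v) / u1 with hFP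
  set FG : ℂ → ℂ := fun z => (G (P z) - G v) / d (j + 1) with hFG
  have hFPc : ContinuousOn FP (ball (0:ℂ) r ∩ {z : ℂ | 0 ≤ z.im}) := (hPc.sub continuousOn_const).div_const _
  have hFPd : DifferentiableOn ℂ FP (ball (0:ℂ) r ∩ {z : ℂ | 0 < z.im}) := by
    have : DifferentiableOn ℂ (fun z => (p z - v) / u1) (ball (0:ℂ) r ∩ {z : ℂ | 0 < z.im}) :=
      (hp.sub_const _).div_const _
    exact this.congr fun z hz => by simp only [hFP, hpP z hz.1 hz.2]
  have hFP0 : FP 0 = 0 := by simp [hFP, hP0, hv]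
  have hFPdiam : ∀ z ∈ ball (0:ℂ) r, z.im = 0 → ∃ μ : ℝ, 0 ≤ μ ∧ (FP z = μ ∨ FP z = μ * exp (((π - g : ℝ) : ℂ) * I)) :=
    fun z hz hzim => dom_rays_at_break hne j (hPdiam z hz hzim)
  have hFPsect : ∀ z ∈ ball (0:ℂ) r, 0 < z.im → 0 < arg (FP z) ∧ arg (FP z) < π - g := by
    intro z hz hzim
    have := dom_sector_at_break hseg harg j (hpD z hz hzim)
    simp only [hFP, hpP z hz hzim]
    exact this
  have hGPc : ContinuousOn (fun z => G (P z)) (ball (0:ℂ) r ∩ {z : ℂ | 0 ≤ z.im}) :=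
    hGc.comp hPc fun z hz => hPcl z hz.1 hz.2
  have hFGc : ContinuousOn FG (ball (0:ℂ) r ∩ {z : ℂ | 0 ≤ z.im}) := (hGPc.sub continuousOn_const).div_const _
  have hGpd : DifferentiableOn ℂ (fun z => G (p z)) (ball (0:ℂ) r ∩ {z : ℂ | 0 < z.im}) :=
    hGd.comp hp fun z hz => hpD z hz.1 hz.2
  have hFGd : DifferentiableOn ℂ FG (ball (0:ℂ) r ∩ {z : ℂ | 0 < z.im}) := by
    have : DifferentiableOn ℂ (fun z => (G (p z) - G v) / d (j + 1)) (ball (0:ℂ) r ∩ {z : ℂ | 0 < z.im}) :=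
      (hGpd.sub_const _).div_const _
    exact this.congr fun z hz => by simp only [hFG, hpP z hz.1 hz.2]
  have hFG0 : FG 0 = 0 := by simp [hFG, hP0, hv]
  have hFGdiam : ∀ z ∈ ball (0:ℂ) r, z.im = 0 →
      ∃ μ : ℝ, 0 ≤ μ ∧ (FG z = μ ∨ FG z = μ * exp (((π - θf j : ℝ) : ℂ) * I)) :=
    fun z hz hzim => img_rays_at_break htlt haff hd1 hd' hmono j (hPdiam z hz hzim)
  have hFGsect : ∀ z ∈ ball (0:ℂ) r, 0 < z.im → 0 < arg (FG z) ∧ arg (FG z) < π - θf j := by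
    intro z hz hzim
    have hint : G (p z) ∈ interior K := by rw [← hGim]; exact mem_image_of_mem G (hpD z hz hzim)
    have := img_sector_at_break ℓ t G d θf K htlt hd0 hd' hθ hmono hstrict j (G (p z)) hint
    simp only [hFG, hpP z hz hzim]
    exact this
  -- derivatives of the straightened maps on the open half-disc
  have hderP : ∀ ζ ∈ ball (0:ℂ) r, 0 < ζ.im → ‖deriv FP ζ‖ = ‖deriv p ζ‖ := by
    intro ζ hζ hζim
    rw [deriv_straighten (q := p) (c := v) (w := u1) hζ hζim (fun z hz hzim => by simp only [hFP, hpP z hz hzim]),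
      norm_div, hu1n, div_one]
  have hderG : ∀ ζ ∈ ball (0:ℂ) r, 0 < ζ.im → ‖deriv FG ζ‖ = ‖deriv G (p ζ)‖ * ‖deriv p ζ‖ := by
    intro ζ hζ hζim
    rw [deriv_straighten (q := fun z => G (p z)) (c := G v) (w := d (j + 1)) hζ hζim
      (fun z hz hzim => by simp only [hFG, hpP z hz hzim]), norm_div, hd1, div_one]
    have h1 : DifferentiableAt ℂ G (p ζ) := hGd.differentiableAt (D.isOpen.mem_nhds (hpD ζ hζ hζim))
    have h2 : DifferentiableAt ℂ p ζ := hp.differentiableAt (hopen.mem_nhds ⟨hζ, hζim⟩)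
    rw [show (fun z => G (p z)) = G ∘ p from rfl, deriv_comp ζ h1 h2, norm_mul]
  -- the three cases
  have hm01 : m = 0 ∨ m = 1 := markInd_eq_zero_or_one D _
  have hθfj : θf j = (2 / 3 : ℝ) * g + π / 3 * m := rfl
  have hθval : θf j = π / 3 ∨ θf j = 2 * π / 3 := hθcases j
  have hgval : g = 0 ∨ g = π / 2 := harg j
  rcases hgval with hg0 | hg2
  · -- straight break point: a mark on a side (`m = 1`, `θ = π/3`)
    have hm1 : m = 1 := by
      rcases hm01 with h0 | h1
      · exfalso; rcases hθval with h | h <;> · rw [hθfj, hg0, h0] at h; linarith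
      · exact h1
    have hθ1 : θf j = π / 3 := by
      rcases hθval with h | h
      · exact h
      · exfalso; rw [hθfj, hg0, hm1] at h; linarith
    -- `p`-side: plain germ bounds
    have hFPreal : ∀ z ∈ ball (0:ℂ) r, z.im = 0 → (FP z).im = 0 := by
      intro z hz hzim
      obtain ⟨μ, -, h | h⟩ := hFPdiam z hz hzim
      · rw [h, ofReal_im]
      · rw [h, hg0, sub_zero, exp_pi_mul_I]; simp
    have hFPpos : ∀ z ∈ ball (0:ℂ) r, 0 < z.im → 0 < (FP z).im := by
      intro z hz hzim
      obtain ⟨h1, h2⟩ := hFPsect z hz hzim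
      exact im_pos_of_arg_mem h1 (by rw [hg0, sub_zero] at h2; exact h2)
    obtain ⟨c, C, r₁, hc, -, hr₁, hr₁r, hbP⟩ := germ_bounds FP r hr hFPc hFPd hFPreal hFP0 hFPpos
    -- `G`-side: opening `2π/3`
    have hang : π - θf j = 2 * π / 3 := by rw [hθ1]; ring
    obtain ⟨C₁, r₂, hC₁, hr₂, hr₂r, hbG⟩ := hex23_deriv_bound FG hr hFGc hFGd hFG0 (by rw [← hang]; exact hFGdiam)
      (by rw [← hang]; exact hFGsect)
    refine ⟨C₁ / c ^ 2, min r₁ r₂, by positivity, lt_min hr₁ hr₂, (min_le_left _ _).trans hr₁r, fun ζ hζ hζim => ⟨?_, ?_⟩⟩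
    · have hζ1 : ζ ∈ ball (0:ℂ) r₁ := ball_subset_ball (min_le_left _ _) hζ
      have hζ2 : ζ ∈ ball (0:ℂ) r₂ := ball_subset_ball (min_le_right _ _) hζ
      have hζr : ζ ∈ ball (0:ℂ) r := ball_subset_ball hr₁r hζ1
      obtain ⟨-, -, hB, -⟩ := hbP ζ hζ1 hζim
      have hGb := hbG ζ hζ2 hζim
      rw [hderP ζ hζr hζim] at hB
      rw [hderG ζ hζr hζim] at hGb
      set A := ‖deriv G (p ζ)‖
      set B := ‖deriv p ζ‖
      rw [le_div_iff₀ (by positivity)]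
      calc A ^ 3 * ‖ζ‖ * B * c ^ 2 ≤ A ^ 3 * ‖ζ‖ * B * B ^ 2 := by gcongr
        _ = (A * B) ^ 3 * ‖ζ‖ := by ring
        _ ≤ C₁ := hGb
    · intro hm0; exfalso
      have : m = 0 := hm0
      rw [hm1] at this; exact one_ne_zero this
  · -- a corner: `p`-side opening `π/2`
    have hang : π - g = π / 2 := by rw [hg2]; ring
    obtain ⟨c, C, r₁, hc, -, hr₁, hr₁r, hbP⟩ := corner_deriv_bounds FP r hr hFPc hFPd hFP0
      (by rw [← hang]; exact hFPdiam) (by rw [← hang]; exact hFPsect)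
    rcases hm01 with hm0 | hm1
    · -- unmarked corner: `θ = π/3`, opening `2π/3`
      have hθ1 : θf j = π / 3 := by rw [hθfj, hg2, hm0]; ring
      have hangG : π - θf j = 2 * π / 3 := by rw [hθ1]; ring
      obtain ⟨C₁, r₂, hC₁, hr₂, hr₂r, hbG⟩ := hex23_deriv_bound FG hr hFGc hFGd hFG0 (by rw [← hangG]; exact hFGdiam)
        (by rw [← hangG]; exact hFGsect)
      have key : ∀ ζ ∈ ball (0:ℂ) (min r₁ r₂), 0 < ζ.im → ‖deriv G (p ζ)‖ ^ 3 * ‖deriv p ζ‖ ≤ C₁ / c := by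
        intro ζ hζ hζim
        have hζ1 : ζ ∈ ball (0:ℂ) r₁ := ball_subset_ball (min_le_left _ _) hζ
        have hζ2 : ζ ∈ ball (0:ℂ) r₂ := ball_subset_ball (min_le_right _ _) hζ
        have hζr : ζ ∈ ball (0:ℂ) r := ball_subset_ball hr₁r hζ1
        obtain ⟨hB, -⟩ := hbP ζ hζ1 hζim
        have hGb := hbG ζ hζ2 hζim
        rw [hderP ζ hζr hζim] at hB
        rw [hderG ζ hζr hζim] at hGb
        set A := ‖deriv G (p ζ)‖
        set B := ‖deriv p ζ‖
        rw [le_div_iff₀ hc]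
        calc A ^ 3 * B * c ≤ A ^ 3 * B * (B ^ 2 * ‖ζ‖) := by gcongr
          _ = (A * B) ^ 3 * ‖ζ‖ := by ring
          _ ≤ C₁ := hGb
      refine ⟨max (C₁ / c) (C₁ / c * r), min r₁ r₂, lt_max_of_lt_left (by positivity), lt_min hr₁ hr₂,
        (min_le_left _ _).trans hr₁r, fun ζ hζ hζim => ⟨?_, fun _ => (key ζ hζ hζim).trans (le_max_left _ _)⟩⟩
      have hk := key ζ hζ hζim
      have hζr : ‖ζ‖ ≤ r := by
        have : ‖ζ‖ < min r₁ r₂ := mem_ball_zero_iff.1 hζ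
        linarith [min_le_left r₁ r₂]
      calc ‖deriv G (p ζ)‖ ^ 3 * ‖ζ‖ * ‖deriv p ζ‖ = ‖deriv G (p ζ)‖ ^ 3 * ‖deriv p ζ‖ * ‖ζ‖ := by ring
        _ ≤ C₁ / c * r := by gcongr
        _ ≤ max (C₁ / c) (C₁ / c * r) := le_max_right _ _
    · -- marked corner: `θ = 2π/3`, opening `π/3`
      have hθ1 : θf j = 2 * π / 3 := by rw [hθfj, hg2, hm1]; ring
      have hangG : π - θf j = π / 3 := by rw [hθ1]; ring
      obtain ⟨C₁, r₂, hC₁, hr₂, hr₂r, hbG⟩ := hex13_deriv_bound FG hr hFGc hFGd hFG0 (by rw [← hangG]; exact hFGdiam)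
        (by rw [← hangG]; exact hFGsect)
      refine ⟨C₁ / c, min r₁ r₂, by positivity, lt_min hr₁ hr₂, (min_le_left _ _).trans hr₁r, fun ζ hζ hζim => ⟨?_, ?_⟩⟩
      · have hζ1 : ζ ∈ ball (0:ℂ) r₁ := ball_subset_ball (min_le_left _ _) hζ
        have hζ2 : ζ ∈ ball (0:ℂ) r₂ := ball_subset_ball (min_le_right _ _) hζ
        have hζr : ζ ∈ ball (0:ℂ) r := ball_subset_ball hr₁r hζ1
        obtain ⟨hB, -⟩ := hbP ζ hζ1 hζim
        have hGb := hbG ζ hζ2 hζim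
        rw [hderP ζ hζr hζim] at hB
        rw [hderG ζ hζr hζim] at hGb
        set A := ‖deriv G (p ζ)‖
        set B := ‖deriv p ζ‖
        rw [le_div_iff₀ hc]
        calc A ^ 3 * ‖ζ‖ * B * c ≤ A ^ 3 * ‖ζ‖ * B * (B ^ 2 * ‖ζ‖) := by gcongr
          _ = (A * B) ^ 3 * ‖ζ‖ ^ 2 := by ring
          _ ≤ C₁ := hGb
      · intro hm0; exfalso
        have : m = 0 := hm0
        rw [hm1] at this; exact one_ne_zero this

end Summit.CriticalPhenomena.CardyFormulaZ2.Cruxes.ParafermionToSLESixFamilies.PotentialDarbouxPicardDiamond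

end
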